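import Summits.Ventures.GridStability.Lyapunov.StructurePreservingSwitchRegion
import HarnessLib

/-!
# GridStability/Lyapunov/StructurePreservingStepKitR — injection-step certificate, VERSION R: the per-edge
# Vu–Turitsyn level (enclosure-robust `ratGapR`) replaces the uniform level `2cos γ − 3.141593 sin γ` of
# `Cert.checkP`, so post-disturbance coupled branch angles up to the polytope edge (not just ≈ 32.5°) certify

Cell `gridfusion` (LADDER-GRIDFUSION), seat gridfusion-lyap-1 (g9); v2 of `StructurePreservingStepKit.lean` (line
«G2.b-NE39SP-LOADSTEP»). `Cert.checkR` = `Cert.checkP` with the edge conjunct `c < w1ₑ·(2 hcos τγ − 3.141593 hsin τγ)`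
replaced by `c < w1ₑ·ratGapR(quot t1_src t1_tgt, 2R)` (this seat's `ratGapR_le_vtGap`, file
`StructurePreservingSwitchRegion.lean`) and `0 ≤ c` added; everything else — margin, windows, supersolution, balance,
residual, energy budget — is identical, so **`exists_equilibrium_of_checkR`** has the proof of
`exists_equilibrium_of_checkP` [cite: DvijothamLowChertkov2015, §3.3 Corollary 1; BermanPlemmons1994, Ch. 6 Thm 2.3].
File 2 `StructurePreservingStepRoaR.lean`: `resync_of_checkR`, `step_resync_of_checkR`. THREE COLUMNS: a certificate
format and its soundness for MODEL MV-3; no sentence here says any grid is stable. One `abbrev`; no named fact;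
standard axioms.
-/

noncomputable section

open Set Filter Topology Real Finset
open Summit.Ventures.GridStability.Models.StructurePreserving
open Summit.Ventures.GridStability.Models.StructurePreserving.Params
open Literature.MathematicalPhysics.PowerSystems

namespace Summit.Ventures.GridStability.Lyapunov.StructurePreserving.Switch

variable {n m : ℕ}

/-- **The ONE decidable check, version R**: as `Cert.checkP` but with the PER-EDGE level conjunct
`c < w1ₑ · ratGapR(q̃ₑ, 2R)` (enclosure-robust Vu–Turitsyn gap) and `0 ≤ c`. An `abbrev`. [folklore] -/
abbrev Cert.checkR (C : Cert n m) (src tgt : Fin m → Fin n) (w1 : Fin m → ℚ) (P1 : Fin n → ℚ)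
    (t0 : Fin n → ℚ) (r : Fin n) : Prop :=
  (0 < C.R ∧ 0 < C.μ ∧ 0 ≤ C.τ1 ∧ C.τ1 ≤ C.τγ ∧ C.τγ < 1 ∧
    C.R * (1 + quot C.τγ C.τ1 ^ 2) ≤ quot C.τγ C.τ1) ∧
  (∀ e, 0 ≤ w1 e ∧ src e ≠ tgt e ∧
    (w1 e = 0 ∨
      (-1 < C.t1 (src e) * C.t1 (tgt e) ∧ |quot (C.t1 (src e)) (C.t1 (tgt e))| ≤ C.τ1 ∧
        -1 < t0 (src e) * t0 (tgt e) ∧ |quot (t0 (src e)) (t0 (tgt e))| ≤ 1 ∧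
        -1 < quot (t0 (src e)) (t0 (tgt e)) * quot (C.t1 (src e)) (C.t1 (tgt e)) ∧
        C.c < w1 e * ratGapR (quot (C.t1 (src e)) (C.t1 (tgt e))) (2 * C.R)))) ∧
  (∀ i, 0 < C.x i ∧ (i ≠ r → C.μ * C.x i ≤ hcos C.τγ * lapQ src tgt w1 C.x i)) ∧
  (0 ≤ C.c ∧ ∑ i, P1 i = 0 ∧
    4 * (∑ i ∈ univ.erase r, (P1 i - flowQ src tgt w1 C.t1 i) ^ 2) < C.μ ^ 2 * C.R ^ 2) ∧
  (∑ e, w1 e * (2 * (|quot (quot (t0 (src e)) (t0 (tgt e)))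
      (quot (C.t1 (src e)) (C.t1 (tgt e)))| + C.R) ^ 2)) ≤ C.c

/-- **Existence and enclosure of the post-step synchronous angle vector (version R).** Edge-list data with
post-step weights `w1`, balanced post-step injections `P1`, pre-step tangents `t0`, reference node `r`, and a
certificate `C` passing `C.checkR`: the couplings `b¹ = symmetrize (edgeWeight src tgt w1)` admit `θ¹` with `θ¹_r = θ̃_r`
(`θ̃ = halfAngle t1`), `|θ¹ᵢ − θ̃ᵢ| < R` at every node, solving ALL `n` power-flow equations
`Σⱼ b¹ᵢⱼ sin(θ¹ᵢ − θ¹ⱼ) = P¹ᵢ` exactly, every coupled pair inside `|θ¹ᵢ − θ¹ⱼ| < 2·arctan τγ`.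
[cite: DvijothamLowChertkov2015, §3.3 Corollary 1; BoydVandenberghe2004, §9.1.2 eq. (9.11)] -/
theorem exists_equilibrium_of_checkR {src tgt : Fin m → Fin n} {w1 : Fin m → ℚ} {P1 : Fin n → ℚ}
    {t0 : Fin n → ℚ} {r : Fin n} {C : Cert n m} (hchk : C.checkR src tgt w1 P1 t0 r) :
    ∃ θ : Fin n → ℝ,
      θ r = halfAngle (fun i => (C.t1 i : ℝ)) r ∧
      (∀ i, |θ i - halfAngle (fun i => (C.t1 i : ℝ)) i| < (C.R : ℝ)) ∧
      (∀ i, ∑ j, symmetrize (edgeWeight src tgt fun e => (w1 e : ℝ)) i j * Real.sin (θ i - θ j)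
        = (P1 i : ℝ)) ∧
      (∀ i j, i ≠ j → symmetrize (edgeWeight src tgt fun e => (w1 e : ℝ)) i j ≠ 0 →
        |θ i - θ j| < 2 * Real.arctan (C.τγ : ℝ)) := by
  obtain ⟨⟨hR, hμ, hτ1, hτ1γ, hτγ1, hmar⟩, hedge, hnode, ⟨-, hsum, hres⟩, -⟩ := hchk
  set W1 : Fin m → ℝ := fun e => (w1 e : ℝ) with hW1
  set T1 : Fin n → ℝ := fun i => (C.t1 i : ℝ) with hT1
  set PR : Fin n → ℝ := fun i => (P1 i : ℝ) with hPR
  set B := symmetrize (edgeWeight src tgt W1) with hB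
  have hW1nn : ∀ e, 0 ≤ W1 e := fun e => by simp only [hW1]; exact_mod_cast (hedge e).1
  have hBs : ∀ i j, B i j = B j i := fun i j => symmetrize_symm _ i j
  have hB0 : ∀ i j, i ≠ j → 0 ≤ B i j := fun i j _ => symmetrize_nonneg (edgeWeight_nonneg hW1nn) i j
  have hP : ∑ i, PR i = 0 := by
    have := congrArg (fun q : ℚ => (q : ℝ)) hsum
    push_cast at this
    exact this
  have hτγ0 : (0 : ℝ) ≤ (C.τγ : ℝ) := by exact_mod_cast hτ1.trans hτ1γ
  have hτγ1' : (C.τγ : ℝ) < 1 := by exact_mod_cast hτγ1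
  have hγπ : 2 * Real.arctan (C.τγ : ℝ) ≤ π := by
    linarith [two_mul_arctan_lt_pi_div_two hτγ1', Real.pi_pos]
  have hc₀ : hcos (C.τγ : ℝ) ≤ Real.cos (2 * Real.arctan (C.τγ : ℝ)) := (hcos_eq_cos _).le
  have hc₀nn : (0 : ℝ) ≤ hcos (C.τγ : ℝ) := by
    unfold hcos
    apply div_nonneg <;> nlinarith
  have hRr : (0 : ℝ) < (C.R : ℝ) := by exact_mod_cast hR
  have hμr : (0 : ℝ) < (C.μ : ℝ) := by exact_mod_cast hμ
  -- (i) margin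
  have hgap : (C.R : ℝ) ≤ Real.arctan (C.τγ : ℝ) - Real.arctan (C.τ1 : ℝ) := by
    have hu0 : (0 : ℝ) ≤ quot (C.τγ : ℝ) (C.τ1 : ℝ) := by
      unfold quot
      apply div_nonneg
      · exact_mod_cast (show (0 : ℚ) ≤ C.τγ - C.τ1 by linarith)
      · have : (0 : ℝ) ≤ (C.τγ : ℝ) * (C.τ1 : ℝ) := mul_nonneg hτγ0 (by exact_mod_cast hτ1)
        linarith
    have hmar' : (C.R : ℝ) * (1 + quot (C.τγ : ℝ) (C.τ1 : ℝ) ^ 2) ≤ quot (C.τγ : ℝ) (C.τ1 : ℝ) := by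
      have := (Rat.cast_le (K := ℝ)).2 hmar
      rw [Rat.cast_mul, Rat.cast_add, Rat.cast_pow, quot_cast, Rat.cast_one] at this
      exact this
    have h1 := le_arctan_of_mul_le hu0 hmar'
    have h2 : 2 * Real.arctan (C.τγ : ℝ) - 2 * Real.arctan (C.τ1 : ℝ)
        = 2 * Real.arctan (quot (C.τγ : ℝ) (C.τ1 : ℝ)) := by
      have hprod : (-1 : ℝ) < (C.τγ : ℝ) * (C.τ1 : ℝ) := by
        have : (0 : ℝ) ≤ (C.τγ : ℝ) * (C.τ1 : ℝ) := mul_nonneg hτγ0 (by exact_mod_cast hτ1)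
        linarith
      exact two_mul_arctan_sub hprod
    linarith
  have hcoh : ∀ i j, i ≠ j → 0 < B i j → |halfAngle T1 i - halfAngle T1 j| + 2 * (C.R : ℝ)
      ≤ 2 * Real.arctan (C.τγ : ℝ) := by
    intro i j _ hpos
    obtain ⟨e, hwe, hor⟩ := exists_ne_zero_edge src tgt W1 hpos.ne'
    have hwe' : w1 e ≠ 0 := fun h => hwe (by simp [hW1, h])
    obtain ⟨hp1, hq1, -, -, -, -⟩ := (hedge e).2.2.resolve_left hwe'
    have hp1' : (-1 : ℝ) < T1 (src e) * T1 (tgt e) := by simp only [hT1]; exact_mod_cast hp1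
    have hq1' : |(T1 (src e) - T1 (tgt e)) / (1 + T1 (src e) * T1 (tgt e))| ≤ (C.τ1 : ℝ) := by
      have := (Rat.cast_le (K := ℝ)).2 hq1
      rw [Rat.cast_abs, quot_cast] at this
      exact this
    have hle : |halfAngle T1 i - halfAngle T1 j| ≤ 2 * Real.arctan (C.τ1 : ℝ) := by
      rcases hor with ⟨hs, ht⟩ | ⟨hs, ht⟩
      · subst hs; subst ht; exact abs_halfAngle_sub_le hp1' hq1'
      · subst hs; subst ht; rw [abs_sub_comm]; exact abs_halfAngle_sub_le hp1' hq1'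
    linarith
  -- (ii) coercivity
  have hsup : ∀ i, i ≠ r → (C.μ : ℝ) * (C.x i : ℝ) ≤ hcos (C.τγ : ℝ) * lapQ src tgt W1 (fun j => (C.x j : ℝ)) i := by
    intro i hi
    have := (Rat.cast_le (K := ℝ)).2 ((hnode i).2 hi)
    rw [Rat.cast_mul, Rat.cast_mul, hcos_cast, lapQ_cast] at this
    exact this
  have hcoer := coercive_of_lapQ src tgt W1 hW1nn r hc₀nn (fun j => (C.x j : ℝ))
    (fun i => by exact_mod_cast (hnode i).1) hsup
  -- (iii) residual
  have hres' : 4 * ∑ i ∈ univ.erase r,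
      (PR i - ∑ j, B i j * Real.sin (halfAngle T1 i - halfAngle T1 j)) ^ 2
      < (C.μ : ℝ) ^ 2 * (C.R : ℝ) ^ 2 := by
    simp_rw [hB, pe_halfAngle_eq_flowQ]
    have := (Rat.cast_lt (K := ℝ)).2 hres
    push_cast at this
    simp_rw [flowQ_cast] at this
    exact this
  obtain ⟨θ, hr, hball, -, heq, hcoh'⟩ :=
    ClassicalModel.exists_equilibrium_of_residual_reference B PR hBs hB0 hP r
      (halfAngle T1) hγπ hc₀ hRr hμr hcoh hcoer hres'
  refine ⟨θ, hr, hball, heq, fun i j hij hne => hcoh' i j hij ?_⟩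
  exact lt_of_le_of_ne (hB0 i j hij) (Ne.symm hne)

end Summit.Ventures.GridStability.Lyapunov.StructurePreserving.Switch

end
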